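/-
Copyright (c) 2026 the pub-hodgecm-mathlib formalisation cell (harness21).  Prover seat hodgecm-mathlib-R90-IF-p01 (g0), programme R90-TF, section S9 «InnerForm-13.3.6 (c)»,
deal «G′-DATUM FIELDS» — the GLOBAL SIGN IDENTITY `(−1)^N c = 1` of (14.6.3) at the datum `Γ₀^{sph}`, under the Rogawski frame, by Hilbert reciprocity.
-/
import Summits.HodgeConjecture.HodgeConjecture.Theorems.R90S9InnerFormSec146SignConstant    -- ★ p862429 (this seat): `gammaSph_sec146_c_of_sign`, `gammaSph_c`, `gammaSph_N`, `cv_*`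
import Summits.HodgeConjecture.HodgeConjecture.Theorems.R90S9InnerFormSec146SignReciprocity -- (this seat): `finprod_formSignAt_eq_neg_one_pow_ncard`, `embedding_equivInfinitePlace`
import HarnessLib

/-!
# R90-TF · S9 — the global sign identity `(−1)^N c = 1` at the datum `Γ₀^{sph}` UNDER THE ROGAWSKI FRAME (Rogawski 1990 §14.6 pp. 243–245; O'Meara 71:18)

Cell `hodgecm-mathlib`, crux H413 = `stmt-HodgeConjecture-24833` (supports-only, count-neutral), route `HCCMUnconditional`; programme R90-TF, section S9, seat R90-IF-p01 (g0).
THEOREMS ONLY (`--kind proof`); no def, no instance, no named-fact hypothesis, no `sorry`.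
MATHEMATICS.  By the sibling `…SignReciprocity`, `c = ∏_p c_p = ∏_{v<∞} ε_v(H) = (−1)^{#{w : −det H <_w 0}}`.  UNDER THE FRAME (`Tᴴ H^ι T = J = diag(1,1,−1)`, `H^{τ′} ≻ 0`
for `τ′ ≁ ι`) both `{w : −det H <_w 0}` and `S₀` are the places `≠ w(ι)`: `det H^{τ′} = τ′(det H) > 0` for `H^{τ′} ≻ 0`; `|det T|² · ι(det H) = det J = −1`; `J` and `−J` are
not `≻ 0`, so `H^ι` is neither `≻ 0` nor `≺ 0` (for both embeddings of the conjugate pair: `H^{τ̄} = (H^τ)ᵀ`).  Hence `N = #S₀ = #{w : −det H <_w 0}` and `(−1)^N c = (−1)^{2N} = 1`,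
which closes ★ `gammaSph_sec146_c_of_sign`: **`gammaSph_sec146_c`** — `sec146_c` holds at `Γ₀^{sph}` for every framed non-degenerate hermitian `H`.  (For an UNFRAMED `H`
the identity can fail — a form negative definite at one compact place flips the parity — consistent with S9-J7 (R-b): the carpet instance lives at framed `H`.)
CONTENTS (ns `…R90.S9.InnerFormSec146`): §16 `finprod_cv_eq_finprod_formSignAt`, `inr_mem_s0_iff`, `inl_not_mem_s0`, `s0_eq_image`, `map_conjugate_eq_transpose`,
`posDef_map_of_mk_eq`, `posDef_neg_map_of_mk_eq`, `not_posDef_J`, `not_posDef_neg_J`, `not_posDef_map_of_frame`, `not_posDef_neg_map_of_frame`, `re_embedding_det_lt_zero_of_frame`,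
`re_embedding_det_pos_of_posDef`; §17 `embedding_of_isReal_negDet_eq`, `setOf_definite_eq_of_frame`, `setOf_negDet_lt_zero_eq_of_frame`, **`neg_one_pow_ncard_s0_mul_finprod_cv`**;
§18 **`gammaSph_neg_one_pow_N_mul_c`**, **`gammaSph_sec146_c (hH) (hdet) (hdef)`**.
HONEST LABEL: sign bookkeeping at the datum; HC_CM is proved only modulo the 7 printed citations (2 remaining named inputs: hLiu418 = `stmt-HodgeConjecture-24832`, h413 =
`stmt-HodgeConjecture-24833`) until rung 0 closes.  References: [Rogawski1990] §14.2 p. 232, §14.6 pp. 243–245; [Omeara1963] §71 Thm. 71:18; [Jacobowitz1962] §3; [BorelJacquet1979] §4.1.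
-/

set_option autoImplicit false
set_option linter.dupNamespace false  -- the mandated namespace repeats the summit's segment (`HodgeConjecture.HodgeConjecture`)

noncomputable section

open NumberField IsDedekindDomain MeasureTheory
open scoped Matrix MatrixGroups ComplexConjugate ComplexOrder
open Literature.NumberTheory Literature.NumberTheory.Automorphic Literature.NumberTheory.Automorphic.UnitaryGroup
open Literature.NumberTheory.QuadraticForms Literature.NumberTheory.Rogawski1990
open Summit.HodgeConjecture.HodgeConjecture.Cruxes.H413 Summit.HodgeConjecture.HodgeConjecture.Cruxes.H413.F0P3GlobalPacket
open Summit.HodgeConjecture.HodgeConjecture.Cruxes.H413.F0P3LocalPacketKit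

namespace Summit.HodgeConjecture.HodgeConjecture.R90.S9.InnerFormSec146

/-! ## §16 Under the Rogawski frame: `#{w : det H >_w 0} = #S₀`, hence `(−1)^N c = 1` and `sec146_c` at `Γ₀^{sph}` -/

section Frame

variable (L : Type) [Field L] [NumberField L] [IsCMField L]

variable (H : Matrix (Fin 3) (Fin 3) L)

/-- `∏ᶠ_p c_p = ∏ᶠ_{v<∞} ε_v(H)` (the archimedean constants are `1`). [cite: Rogawski1990, §14.6 p. 243] -/
theorem finprod_cv_eq_finprod_formSignAt :
    (∏ᶠ p : Place L, cv L H p) = ∏ᶠ v : HeightOneSpectrum (𝓞 ↥(maximalRealSubfield L)), (formSignAt L (IsCMField.complexConj L) H v : ℂ) := by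
  calc (∏ᶠ p : Place L, cv L H p) = ∏ᶠ p ∈ (Set.univ : Set (Place L)), cv L H p := (finprod_mem_univ _).symm
    _ = ∏ᶠ p ∈ Set.range (Sum.inl : HeightOneSpectrum (𝓞 ↥(maximalRealSubfield L)) → Place L), cv L H p := by
        refine finprod_mem_inter_mulSupport_eq' _ _ _ fun p hp => ⟨fun _ => ?_, fun _ => Set.mem_univ _⟩
        cases p with
        | inl v => exact ⟨v, rfl⟩
        | inr w => exact absurd (cv_inr L H w) hp
    _ = ∏ᶠ v : HeightOneSpectrum (𝓞 ↥(maximalRealSubfield L)), cv L H (Sum.inl v) := finprod_mem_range Sum.inl_injective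
    _ = ∏ᶠ v : HeightOneSpectrum (𝓞 ↥(maximalRealSubfield L)), (formSignAt L (IsCMField.complexConj L) H v : ℂ) := finprod_congr fun v => cv_inl L H v

omit [NumberField L] [IsCMField L] in
/-- `inr w′ ∈ S₀ ↔ H^{w′} ≻ 0 ∨ −H^{w′} ≻ 0` (unfolding of ed. 1's `S0`). [cite: Rogawski1990, §14.2 p. 232] -/
theorem inr_mem_s0_iff (w' : InfinitePlace L) :
    (Sum.inr w' : Place L) ∈ S0 L H ↔ (H.map w'.embedding).PosDef ∨ (-(H.map w'.embedding)).PosDef := by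
  constructor
  · rintro ⟨w, hw, h⟩
    cases Sum.inr_injective hw
    exact h
  · exact fun h => ⟨w', rfl, h⟩

omit [NumberField L] [IsCMField L] in
/-- No finite place lies in `S₀`. [cite: Rogawski1990, §14.2 p. 232] -/
theorem inl_not_mem_s0 (v : HeightOneSpectrum (𝓞 ↥(maximalRealSubfield L))) : (Sum.inl v : Place L) ∉ S0 L H := by
  rintro ⟨w, hw, -⟩
  exact Sum.inl_ne_inr hw

omit [NumberField L] [IsCMField L] in
/-- `S₀ = inr '' {w′ | H^{w′} ≻ 0 ∨ −H^{w′} ≻ 0}`. [cite: Rogawski1990, §14.2 p. 232] -/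
theorem s0_eq_image :
    S0 L H = (Sum.inr : InfinitePlace L → Place L) '' {w' : InfinitePlace L | (H.map w'.embedding).PosDef ∨ (-(H.map w'.embedding)).PosDef} := by
  ext p
  cases p with
  | inl v => exact ⟨fun h => absurd h (inl_not_mem_s0 L H v), by rintro ⟨w, -, hw⟩; exact absurd hw Sum.inr_ne_inl⟩
  | inr w =>
    refine (inr_mem_s0_iff L H w).trans ⟨fun h => ⟨w, h, rfl⟩, ?_⟩
    rintro ⟨w₁, h₁, hw⟩
    cases Sum.inr_injective hw
    exact h₁

variable {L H}

/-- For a CM-hermitian `H`, the CONJUGATE embedding transposes: `H^{τ̄} = (H^τ)ᵀ`. [cite: BorelJacquet1979, §4.1] -/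
theorem map_conjugate_eq_transpose (hH : (H.map (cmConjRingHom L))ᵀ = H) (τ : L →+* ℂ) :
    H.map (ComplexEmbedding.conjugate τ) = (H.map τ)ᵀ := by
  ext i j
  have h0 : cmConjRingHom L (H j i) = H i j := by
    have h := congrFun (congrFun hH i) j
    simpa only [Matrix.transpose_apply, Matrix.map_apply] using h
  rw [Matrix.map_apply, Matrix.transpose_apply, Matrix.map_apply, ComplexEmbedding.conjugate_coe_eq, ← h0]
  show conj (τ (IsCMField.complexConj L (H j i))) = τ (H j i)
  rw [IsCMField.complexEmbedding_complexConj, Complex.conj_conj]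

/-- Positivity at a complex place does not depend on the choice of embedding in the conjugate pair. [cite: BorelJacquet1979, §4.1] -/
theorem posDef_map_of_mk_eq (hH : (H.map (cmConjRingHom L))ᵀ = H) {τ τ' : L →+* ℂ} (h : InfinitePlace.mk τ = InfinitePlace.mk τ')
    (hτ : (H.map τ).PosDef) : (H.map τ').PosDef := by
  rcases InfinitePlace.mk_eq_iff.1 h with rfl | rfl
  · exact hτ
  · rw [map_conjugate_eq_transpose hH]
    exact hτ.transpose

/-- The same for negative definiteness. [cite: BorelJacquet1979, §4.1] -/
theorem posDef_neg_map_of_mk_eq (hH : (H.map (cmConjRingHom L))ᵀ = H) {τ τ' : L →+* ℂ} (h : InfinitePlace.mk τ = InfinitePlace.mk τ')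
    (hτ : (-(H.map τ)).PosDef) : (-(H.map τ')).PosDef := by
  rcases InfinitePlace.mk_eq_iff.1 h with rfl | rfl
  · exact hτ
  · rw [map_conjugate_eq_transpose hH, ← Matrix.transpose_neg]
    exact hτ.transpose

variable {ι : L →+* ℂ} {T : GL (Fin 3) ℂ}

/-- `J = diag(1,1,−1)` is not positive definite (`J₂₂ = −1`). [cite: Jacobowitz1962, §3 Thm. 3.1] -/
theorem not_posDef_J : ¬ Literature.Geometry.ComplexHyperbolic.BallModel.J.PosDef := by
  intro h
  have h2 := h.diag_pos (i := 2)
  rw [Literature.Geometry.ComplexHyperbolic.BallModel.J_apply_22, Complex.lt_def] at h2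
  norm_num at h2

/-- `−J` is not positive definite (`(−J)₀₀ = −1`). [cite: Jacobowitz1962, §3 Thm. 3.1] -/
theorem not_posDef_neg_J : ¬ (-Literature.Geometry.ComplexHyperbolic.BallModel.J).PosDef := by
  intro h
  have h0 := h.diag_pos (i := 0)
  rw [Matrix.neg_apply, Literature.Geometry.ComplexHyperbolic.BallModel.J_apply_00, Complex.lt_def] at h0
  norm_num at h0

omit [NumberField L] [IsCMField L] in
/-- **Under the frame `Tᴴ H^ι T = J`, `H^ι` is NOT positive definite** (else `J` would be). [cite: Rogawski1990, §14.2 p. 232] -/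
theorem not_posDef_map_of_frame (hT : (T : Matrix (Fin 3) (Fin 3) ℂ)ᴴ * H.map ι * (T : Matrix (Fin 3) (Fin 3) ℂ) = Literature.Geometry.ComplexHyperbolic.BallModel.J) :
    ¬ (H.map ι).PosDef := fun h =>
  not_posDef_J (hT ▸ h.conjTranspose_mul_mul_same (Matrix.mulVec_injective_of_isUnit (Units.isUnit T)))

omit [NumberField L] [IsCMField L] in
/-- **Under the frame, `−H^ι` is NOT positive definite** (else `−J` would be). [cite: Rogawski1990, §14.2 p. 232] -/
theorem not_posDef_neg_map_of_frame (hT : (T : Matrix (Fin 3) (Fin 3) ℂ)ᴴ * H.map ι * (T : Matrix (Fin 3) (Fin 3) ℂ) = Literature.Geometry.ComplexHyperbolic.BallModel.J) :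
    ¬ (-(H.map ι)).PosDef := fun h => by
  have h' := h.conjTranspose_mul_mul_same (Matrix.mulVec_injective_of_isUnit (Units.isUnit T))
  rw [Matrix.mul_neg, Matrix.neg_mul, hT] at h'
  exact not_posDef_neg_J h'

omit [NumberField L] [IsCMField L] in
/-- **Under the frame, `ι(det H)` is a NEGATIVE real**: `|det T|² · ι(det H) = det J = −1`. [cite: Rogawski1990, §14.2 p. 232] -/
theorem re_embedding_det_lt_zero_of_frame (hT : (T : Matrix (Fin 3) (Fin 3) ℂ)ᴴ * H.map ι * (T : Matrix (Fin 3) (Fin 3) ℂ) = Literature.Geometry.ComplexHyperbolic.BallModel.J) :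
    (ι H.det).re < 0 := by
  have h := congrArg Matrix.det hT
  rw [Matrix.det_mul, Matrix.det_mul, Matrix.det_conjTranspose, Literature.Geometry.ComplexHyperbolic.BallModel.det_J, ← RingHom.mapMatrix_apply,
    ← RingHom.map_det] at h
  -- `h : star (det T) * ι (det H) * det T = -1`
  set z : ℂ := ((T : Matrix (Fin 3) (Fin 3) ℂ)).det with hz
  have hz0 : z ≠ 0 := ((Matrix.isUnit_iff_isUnit_det _).1 (Units.isUnit T)).ne_zero
  have hnorm : star z * ι H.det * z = (Complex.normSq z : ℂ) * ι H.det := by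
    rw [Complex.star_def, Complex.normSq_eq_conj_mul_self]; ring
  rw [hnorm] at h
  have hns : 0 < Complex.normSq z := Complex.normSq_pos.2 hz0
  have hre := congrArg Complex.re h
  rw [Complex.re_ofReal_mul, Complex.neg_re, Complex.one_re] at hre
  by_contra hge
  push Not at hge
  nlinarith [mul_nonneg hns.le hge]

omit [NumberField L] [IsCMField L] in
/-- At a positive definite complex place, `τ(det H)` is a POSITIVE real (`det H^τ > 0`). [cite: Rogawski1990, §14.2 p. 232] -/
theorem re_embedding_det_pos_of_posDef {τ : L →+* ℂ} (hτ : (H.map τ).PosDef) : 0 < (τ H.det).re := by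
  have h := (Complex.lt_def.1 hτ.det_pos).1
  rw [RingHom.map_det, RingHom.mapMatrix_apply]
  simpa using h

end Frame

/-! ## §17 Assembly: the two place counts agree under the frame; `(−1)^N c = 1`; `sec146_c` at `Γ₀^{sph}` -/

section Assembly

variable (L : Type) [Field L] [NumberField L] [IsCMField L] (H : Matrix (Fin 3) (Fin 3) L)

variable {L H}

/-- The real number `(−det H)` at the place of `L⁺` below `w′` is `−Re w′(det H)`. [cite: Rogawski1990, §14.2 p. 232] -/
theorem embedding_of_isReal_negDet_eq (hH : (H.map (cmConjRingHom L))ᵀ = H) (w' : InfinitePlace L) (hw : (IsCMField.equivInfinitePlace L w').IsReal) :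
    InfinitePlace.embedding_of_isReal hw (⟨-H.det, neg_det_mem_maximalRealSubfield_of_isHermitian L hH⟩ : ↥(maximalRealSubfield L)) =
      -(w'.embedding H.det).re := by
  have h1 := InfinitePlace.embedding_of_isReal_apply hw (⟨-H.det, neg_det_mem_maximalRealSubfield_of_isHermitian L hH⟩ : ↥(maximalRealSubfield L))
  rw [embedding_equivInfinitePlace, RingHom.comp_apply] at h1
  have h2 : w'.embedding (algebraMap (↥(maximalRealSubfield L)) L ⟨-H.det, neg_det_mem_maximalRealSubfield_of_isHermitian L hH⟩) = -w'.embedding H.det := by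
    rw [← map_neg]
    rfl
  rw [h2] at h1
  have h3 := congrArg Complex.re h1
  rwa [Complex.ofReal_re, Complex.neg_re] at h3

variable {ι : L →+* ℂ} {T : GL (Fin 3) ℂ}

/-- **UNDER THE FRAME, `S₀` = the places `≠ w(ι)`**: `H^{τ′} ≻ 0` off `ι` (`hdef`), and at `w(ι)` neither `H ≻ 0` nor `−H ≻ 0` (`not_posDef_map_of_frame`, both embeddings of the pair).
[cite: Rogawski1990, §14.2 p. 232] -/
theorem setOf_definite_eq_of_frame (hH : (H.map (cmConjRingHom L))ᵀ = H)
    (hT : (T : Matrix (Fin 3) (Fin 3) ℂ)ᴴ * H.map ι * (T : Matrix (Fin 3) (Fin 3) ℂ) = Literature.Geometry.ComplexHyperbolic.BallModel.J)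
    (hdef : ∀ τ' : L →+* ℂ, InfinitePlace.mk τ' ≠ InfinitePlace.mk ι → (H.map τ').PosDef) :
    {w' : InfinitePlace L | (H.map w'.embedding).PosDef ∨ (-(H.map w'.embedding)).PosDef} = {w' | w' ≠ InfinitePlace.mk ι} := by
  ext w'
  simp only [Set.mem_setOf_eq]
  constructor
  · rintro (h | h) heq
    · have hmk : InfinitePlace.mk w'.embedding = InfinitePlace.mk ι := by rw [InfinitePlace.mk_embedding]; exact heq
      exact not_posDef_map_of_frame hT (posDef_map_of_mk_eq hH hmk h)
    · have hmk : InfinitePlace.mk w'.embedding = InfinitePlace.mk ι := by rw [InfinitePlace.mk_embedding]; exact heq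
      exact not_posDef_neg_map_of_frame hT (posDef_neg_map_of_mk_eq hH hmk h)
  · intro hne
    exact Or.inl (hdef w'.embedding (by rwa [InfinitePlace.mk_embedding]))

/-- **UNDER THE FRAME, the real places where `−det H < 0` are the places below `w′ ≠ w(ι)`**: `det H^{τ′} > 0` for `H^{τ′} ≻ 0`, while `|det T|² · ι(det H) = −1`.
[cite: Rogawski1990, §14.2 p. 232] -/
theorem setOf_negDet_lt_zero_eq_of_frame (hH : (H.map (cmConjRingHom L))ᵀ = H)
    (hT : (T : Matrix (Fin 3) (Fin 3) ℂ)ᴴ * H.map ι * (T : Matrix (Fin 3) (Fin 3) ℂ) = Literature.Geometry.ComplexHyperbolic.BallModel.J)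
    (hdef : ∀ τ' : L →+* ℂ, InfinitePlace.mk τ' ≠ InfinitePlace.mk ι → (H.map τ').PosDef) :
    {w : InfinitePlace ↥(maximalRealSubfield L) | ∃ hw : w.IsReal,
        InfinitePlace.embedding_of_isReal hw (⟨-H.det, neg_det_mem_maximalRealSubfield_of_isHermitian L hH⟩ : ↥(maximalRealSubfield L)) < 0} =
      (IsCMField.equivInfinitePlace L) '' {w' : InfinitePlace L | w' ≠ InfinitePlace.mk ι} := by
  ext w
  simp only [Set.mem_setOf_eq, Set.mem_image]
  constructor
  · rintro ⟨hw, hlt⟩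
    refine ⟨(IsCMField.equivInfinitePlace L).symm w, ?_, Equiv.apply_symm_apply _ _⟩
    intro heq
    have hw' : (IsCMField.equivInfinitePlace L ((IsCMField.equivInfinitePlace L).symm w)).IsReal := by rwa [Equiv.apply_symm_apply]
    have hval := embedding_of_isReal_negDet_eq hH ((IsCMField.equivInfinitePlace L).symm w) hw'
    have hlt' : InfinitePlace.embedding_of_isReal hw'
        (⟨-H.det, neg_det_mem_maximalRealSubfield_of_isHermitian L hH⟩ : ↥(maximalRealSubfield L)) < 0 := by
      convert hlt using 2; simp
    rw [hval, heq] at hlt'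
    -- at `w(ι)` the embedding is `ι` or its conjugate; either way `Re (det H) = Re ι(det H) < 0`
    have hre : ((InfinitePlace.mk ι).embedding H.det).re = (ι H.det).re := by
      rcases InfinitePlace.embedding_mk_eq ι with h | h
      · rw [h]
      · rw [h, ComplexEmbedding.conjugate_coe_eq, Complex.conj_re]
    rw [hre] at hlt'
    have := re_embedding_det_lt_zero_of_frame (H := H) hT
    linarith
  · rintro ⟨w', hne, rfl⟩
    refine ⟨isReal_equivInfinitePlace L w', ?_⟩
    rw [embedding_of_isReal_negDet_eq hH w' (isReal_equivInfinitePlace L w'), neg_lt_zero]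
    exact re_embedding_det_pos_of_posDef (hdef w'.embedding (by rwa [InfinitePlace.mk_embedding]))

/-- **`(−1)^{#S₀} · ∏_p c_p = 1` UNDER THE FRAME** — print's `(−1)^N c = 1` for the datum's constants, by Hilbert reciprocity (§15) and the two frame counts (§17).
[cite: Rogawski1990, §14.6 p. 245 «`(−1)^N c = 1`»] [cite: Omeara1963, §71 Thm. 71:18] -/
theorem neg_one_pow_ncard_s0_mul_finprod_cv (hH : (H.map (cmConjRingHom L))ᵀ = H) (hdet : H.det ≠ 0)
    (hT : (T : Matrix (Fin 3) (Fin 3) ℂ)ᴴ * H.map ι * (T : Matrix (Fin 3) (Fin 3) ℂ) = Literature.Geometry.ComplexHyperbolic.BallModel.J)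
    (hdef : ∀ τ' : L →+* ℂ, InfinitePlace.mk τ' ≠ InfinitePlace.mk ι → (H.map τ').PosDef) :
    (-1 : ℂ) ^ (S0 L H).ncard * ∏ᶠ p : Place L, cv L H p = 1 := by
  have hN : (S0 L H).ncard = {w' : InfinitePlace L | w' ≠ InfinitePlace.mk ι}.ncard := by
    rw [s0_eq_image, setOf_definite_eq_of_frame hH hT hdef]
    exact Set.ncard_image_of_injective _ Sum.inr_injective
  have hc : (∏ᶠ p : Place L, cv L H p) = (-1) ^ {w' : InfinitePlace L | w' ≠ InfinitePlace.mk ι}.ncard := by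
    rw [finprod_cv_eq_finprod_formSignAt, finprod_formSignAt_eq_neg_one_pow_ncard L H hH hdet, setOf_negDet_lt_zero_eq_of_frame hH hT hdef,
      Set.ncard_image_of_injective _ (IsCMField.equivInfinitePlace L).injective]
  rw [hN, hc, ← pow_add, ← two_mul, pow_mul, neg_one_sq, one_pow]

end Assembly

/-! ## §18 At `Γ₀^{sph}`: `(−1)^N c = 1` and `sec146_c`, unconditional under the frame -/

section AtDatum

variable (TG' TG TH : Type) (L : Type) [Field L] [NumberField L] [IsCMField L] (ι : L →+* ℂ) (H : Matrix (Fin 3) (Fin 3) L) (T : GL (Fin 3) ℂ)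
  (hT : (T : Matrix (Fin 3) (Fin 3) ℂ)ᴴ * H.map ι * (T : Matrix (Fin 3) (Fin 3) ℂ) = Literature.Geometry.ComplexHyperbolic.BallModel.J)
  (μA : Measure (adelicGroupData (↥(maximalRealSubfield L)) L (IsCMField.complexConj L) 3 H).automorphicQuotient)
  [(adelicGroupData (↥(maximalRealSubfield L)) L (IsCMField.complexConj L) 3 H).IsAutomorphicMeasure μA]
  (Ξ : OneDimAutRepH L → PacketPrimeFin L H) {H' : Matrix (Fin 3) (Fin 3) L}
  (𝔩 : ∀ v : HeightOneSpectrum (𝓞 ↥(maximalRealSubfield L)), LocalPacketKit L H' v)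
  (X : DatumInputs TG' TG TH L ι H T hT μA Ξ 𝔩)

/-- **`(−1)^N c = 1` at the datum `Γ₀^{sph}`**, for framed `H` (`hT`, `hdef`). [cite: Rogawski1990, §14.6 p. 245] [cite: Omeara1963, §71 Thm. 71:18] -/
theorem gammaSph_neg_one_pow_N_mul_c (hH : (H.map (cmConjRingHom L))ᵀ = H) (hdet : H.det ≠ 0)
    (hdef : ∀ τ' : L →+* ℂ, InfinitePlace.mk τ' ≠ InfinitePlace.mk ι → (H.map τ').PosDef) :
    (-1 : ℂ) ^ (gammaSph TG' TG TH L ι H T hT μA Ξ 𝔩 X).N * (gammaSph TG' TG TH L ι H T hT μA Ξ 𝔩 X).c = 1 := by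
  rw [gammaSph_N, gammaSph_c]
  exact neg_one_pow_ncard_s0_mul_finprod_cv hH hdet hT hdef

/-- **`sec146_c` AT THE DATUM `Γ₀^{sph}`, UNCONDITIONAL UNDER THE FRAME**: `S₀` finite, `c_v = 1` for almost all `v`, `c = ±1`, `(−1)^N c = 1`.
[cite: Rogawski1990, §14.6 pp. 243–245] [cite: Omeara1963, §71 Thm. 71:18] -/
theorem gammaSph_sec146_c (hH : (H.map (cmConjRingHom L))ᵀ = H) (hdet : H.det ≠ 0)
    (hdef : ∀ τ' : L →+* ℂ, InfinitePlace.mk τ' ≠ InfinitePlace.mk ι → (H.map τ').PosDef) :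
    (gammaSph TG' TG TH L ι H T hT μA Ξ 𝔩 X).sec146_c :=
  gammaSph_sec146_c_of_sign TG' TG TH L ι H T hT μA Ξ 𝔩 X hH hdet (gammaSph_neg_one_pow_N_mul_c TG' TG TH L ι H T hT μA Ξ 𝔩 X hH hdet hdef)

end AtDatum



end Summit.HodgeConjecture.HodgeConjecture.R90.S9.InnerFormSec146

end
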